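import Literature.Geometry.Kaehler.DolbeaultChartAcyclic
import Literature.NumberTheory.Transcendental.DolbeaultIntegrabilityProofs
import Literature.NumberTheory.Transcendental.ComplexFormsProofs
import Literature.Geometry.Kaehler.PluriharmonicLog

/-!
# Route NikulinTwinTransport — `LefschetzOneOneK3`, `∂∂̄`–exponential line: holomorphy and `∂̄` of functions

Pointwise Cauchy–Riemann calculus for complex functions viewed as `0`-forms on a complex manifold
(`MForm.ofFun`): `∂̄f = (df)^{0,1}`, `∂f = (df)^{1,0}`; the `(0,1)`-component of a `1`-form at a
point vanishes iff the form is rotation-equivariant of weight `1` there; hence `∂̄f = 0` at the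
points of an open set iff `f` is holomorphic there (for `f` real-`C^∞`), `∂f = df` for
holomorphic `f`, and `∂f = 0` for antiholomorphic `f` (Voisin I, §2.3.3, Lemma 2.29;
Griffiths–Harris p. 2). Helper file for the reduction of the route item `LefschetzOneOneK3`.
-/

noncomputable section

open scoped Manifold ContDiff Topology ComplexConjugate
open Set Filter
open Literature.Geometry.Kaehler
open Literature.NumberTheory.Transcendental

namespace Summit.HodgeConjecture.HodgeConjecture.Theorems

section Holomorphy

variable {E : Type} [NormedAddCommGroup E] [NormedSpace ℂ E]
  {M : Type} [TopologicalSpace M] [ChartedSpace E M]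

/-! ### `0`-forms have type `(0,0)`; `∂̄f = (df)^{0,1}`, `∂f = (df)^{1,0}` -/

/-- Every `0`-form has type `(0,0)`. [folklore] -/
theorem isOfType_zero_zero (φ : MForm 𝓘(ℝ, E) M ℂ 0) : IsOfType 0 0 φ :=
  ⟨rfl, fun x θ v ↦ by
    have hv : (fun i ↦ tangentRotate E x θ (v i)) = v := funext fun i ↦ Fin.elim0 i
    rw [hv]; simp⟩

/-- `∂̄` of a `0`-form is the `(0,1)`-component of its differential. [cite: VoisinHodgeI2002, §2.3.3] -/
theorem dolbeaultBar_zeroForm (φ : MForm 𝓘(ℝ, E) M ℂ 0) :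
    dolbeaultBar φ = (mextDeriv φ).typeComponent 0 1 :=
  IsOfType.dolbeaultBar_eq_holds (isOfType_zero_zero φ)

/-- `∂` of a `0`-form is the `(1,0)`-component of its differential. [cite: VoisinHodgeI2002, §2.3.3] -/
theorem dolbeault_zeroForm (φ : MForm 𝓘(ℝ, E) M ℂ 0) :
    dolbeault φ = (mextDeriv φ).typeComponent 1 0 :=
  IsOfType.dolbeault_eq_holds (isOfType_zero_zero φ)

/-- **Type decomposition of a `1`-form at a point**: `γ_x = γ^{1,0}_x + γ^{0,1}_x`.
[cite: VoisinHodgeI2002, §2.3.1] -/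
theorem apply_eq_typeComponent_add (γ : MForm 𝓘(ℝ, E) M ℂ 1) (x : M) :
    γ x = γ.typeComponent 1 0 x + γ.typeComponent 0 1 x := by
  have h := congrFun (sum_antidiagonal_typeComponent_holds γ) x
  rw [Finset.sum_apply, Finset.sum_eq_add (1, 0) (0, 1) (by simp)] at h
  · exact h.symm
  · rintro ⟨a, b⟩ hc hne
    simp only [Finset.mem_antidiagonal] at hc
    simp only [ne_eq, Prod.mk.injEq, not_and] at hne
    omega
  · simp
  · simp

/-- `d = ∂ + ∂̄` on `0`-forms, pointwise and unconditionally (type decomposition of the `1`-form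
`dφ`). [cite: VoisinHodgeI2002, §2.3.1] -/
theorem mextDeriv_zeroForm_apply (φ : MForm 𝓘(ℝ, E) M ℂ 0) (x : M) :
    mextDeriv φ x = dolbeault φ x + dolbeaultBar φ x := by
  rw [dolbeault_zeroForm, dolbeaultBar_zeroForm]
  exact apply_eq_typeComponent_add (mextDeriv φ) x

/-! ### The `(0,1)`-component of a `1`-form at a point -/

/-- **The `(0,1)`-component of a `1`-form at `x` vanishes iff the form is rotation-equivariant of
weight `1` at `x`**: `β_x(e^{iθ} v) = e^{iθ} β_x(v)` (i.e. `β_x` is `ℂ`-linear). (→): `β = β^{1,0} +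
β^{0,1}` and `β^{1,0}` transforms with weight `1`; (←): the weight `-1` Fourier average of a
weight-`1` function is `(1/3) ∑_j e^{2iθ_j} = 0`. [cite: VoisinHodgeI2002, §2.3.1] -/
theorem typeComponent_zero_one_apply_eq_zero_iff (β : MForm 𝓘(ℝ, E) M ℂ 1) (x : M) :
    β.typeComponent 0 1 x = 0 ↔
      ∀ (θ : ℝ) (v : Fin 1 → TangentSpace 𝓘(ℝ, E) x),
        β x (⇑(tangentRotate E x θ) ∘ v) = Complex.exp (θ * Complex.I) * β x v := by
  constructor
  · intro h0 θ v
    have h10 : IsOfType 1 0 (β.typeComponent 1 0) :=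
      isOfType_typeComponent_holds (p := 1) (q := 0) rfl β
    have key := h10.2 x θ v
    have hsum := apply_eq_typeComponent_add β x
    rw [h0, add_zero] at hsum
    have e1 : (((1 : ℕ) : ℤ) - ((0 : ℕ) : ℤ) : ℤ) = 1 := by norm_num
    rw [e1, Int.cast_one, one_mul] at key
    rw [hsum]
    exact key
  · intro h
    rw [MForm.typeComponent, if_pos rfl]
    ext v
    simp only [MForm.weightComponent, ContinuousAlternatingMap.smul_apply,
      ContinuousAlternatingMap.sum_apply, ContinuousAlternatingMap.compContinuousLinearMap_apply,
      ContinuousAlternatingMap.coe_zero, Pi.zero_apply, smul_eq_mul, h]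
    rw [Finset.sum_congr rfl (g := fun j : Fin (2 * 1 + 1) ↦
      Complex.exp (((2 : ℤ) : ℂ) * ((2 * Real.pi * (j : ℕ) / (2 * ((1 : ℕ) : ℝ) + 1) : ℝ) : ℂ) *
        Complex.I) * β x v) (fun j _ ↦ by
          rw [← mul_assoc, ← Complex.exp_add]
          congr 2
          push_cast
          ring),
      ← Finset.sum_mul, sum_exp_mul_rootAngle_mul_I_eq_zero (k := 1) (d := 2) (by norm_num)
        (by norm_num), zero_mul, mul_zero]

/-! ### Functions: the differential as a `1`-form and the chart derivative -/

variable [IsManifold 𝓘(ℝ, E) ∞ M]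

/-- The chart derivative of `f` at `x`: `D(f ∘ φₓ⁻¹)(φₓ x)`. [cite: WarnerGTM94, 2.20] -/
theorem mextDeriv_ofFun_apply' (f : M → ℂ) (x : M) (v : Fin 1 → TangentSpace 𝓘(ℝ, E) x) :
    mextDeriv (MForm.ofFun 𝓘(ℝ, E) f) x v =
      fderiv ℝ (f ∘ (extChartAt 𝓘(ℝ, E) x).symm) (extChartAt 𝓘(ℝ, E) x x) (v 0) := by
  rw [mextDeriv_ofFun_apply, ModelWithCorners.Boundaryless.range_eq_univ, fderivWithin_univ]

/-- Rotation-equivariance of `df` at `x` is rotation-equivariance of the chart derivative.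
[folklore] -/
theorem mextDeriv_ofFun_rotate_iff (f : M → ℂ) (x : M) :
    (∀ (θ : ℝ) (v : Fin 1 → TangentSpace 𝓘(ℝ, E) x),
        mextDeriv (MForm.ofFun 𝓘(ℝ, E) f) x (⇑(tangentRotate E x θ) ∘ v) =
          Complex.exp (θ * Complex.I) * mextDeriv (MForm.ofFun 𝓘(ℝ, E) f) x v) ↔
      ∀ (θ : ℝ) (w : E),
        fderiv ℝ (f ∘ (extChartAt 𝓘(ℝ, E) x).symm) (extChartAt 𝓘(ℝ, E) x x)
            (Complex.exp (θ * Complex.I) • w) =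
          Complex.exp (θ * Complex.I) *
            fderiv ℝ (f ∘ (extChartAt 𝓘(ℝ, E) x).symm) (extChartAt 𝓘(ℝ, E) x x) w := by
  constructor
  · intro h θ w
    have := h θ ![w]
    rw [mextDeriv_ofFun_apply', mextDeriv_ofFun_apply'] at this
    exact this
  · intro h θ v
    rw [mextDeriv_ofFun_apply', mextDeriv_ofFun_apply']
    exact h θ (v 0)

/-- A real continuous linear functional on a complex space which is equivariant under the circle
`e^{iθ}` is `ℂ`-linear. [folklore] -/
theorem exists_restrictScalars_eq_of_rotate {D : E →L[ℝ] ℂ}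
    (h : ∀ (θ : ℝ) (w : E), D (Complex.exp (θ * Complex.I) • w) = Complex.exp (θ * Complex.I) * D w) :
    ∃ g : E →L[ℂ] ℂ, g.restrictScalars ℝ = D := by
  have hc : ∀ (c : ℂ) (w : E), D (c • w) = c * D w := by
    intro c w
    have hpolar : c = (‖c‖ : ℂ) * Complex.exp (Complex.arg c * Complex.I) :=
      (Complex.norm_mul_exp_arg_mul_I c).symm
    rw [hpolar, mul_smul, Complex.coe_smul, D.map_smul, h, Complex.real_smul, mul_assoc]
  refine ⟨{ toFun := D, map_add' := D.map_add, map_smul' := hc, cont := D.cont }, ?_⟩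
  ext w; rfl

/-! ### `∂̄f = 0` iff `f` is holomorphic -/

/-- **`∂̄`-closed functions are holomorphic**: if `f` is real-`C^∞` at the points of an open `V`
(as a `0`-form) and `∂̄f = 0` there, then `f` is holomorphic on `V`. [cite: VoisinHodgeI2002, §2.3.3 Lemma 2.29] -/
theorem mdifferentiableOn_of_dolbeaultBar_ofFun_eq_zero {V : Set M} {f : M → ℂ}
    (hf : ∀ x ∈ V, (MForm.ofFun 𝓘(ℝ, E) f).SmoothAt x)
    (h0 : ∀ x ∈ V, dolbeaultBar (MForm.ofFun 𝓘(ℝ, E) f) x = 0) :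
    MDifferentiableOn 𝓘(ℂ, E) 𝓘(ℂ, ℂ) f V := by
  intro x hx
  -- real differentiability in the chart at `x`
  have hsm : ContDiffAt ℝ ∞ (f ∘ (extChartAt 𝓘(ℝ, E) x).symm) (extChartAt 𝓘(ℝ, E) x x) := by
    have h := (MForm.smoothAt_ofFun_iff (I := 𝓘(ℝ, E)) f x).1 (hf x hx)
    rwa [ModelWithCorners.Boundaryless.range_eq_univ, contDiffWithinAt_univ] at h
  have hdR : DifferentiableAt ℝ (f ∘ (extChartAt 𝓘(ℝ, E) x).symm) (extChartAt 𝓘(ℝ, E) x x) :=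
    hsm.differentiableAt (by simp)
  -- the chart derivative is `ℂ`-linear
  have hrot := (mextDeriv_ofFun_rotate_iff f x).1
    ((typeComponent_zero_one_apply_eq_zero_iff (mextDeriv (MForm.ofFun 𝓘(ℝ, E) f)) x).1
      (by rw [← dolbeaultBar_zeroForm]; exact h0 x hx))
  obtain ⟨g, hg⟩ := exists_restrictScalars_eq_of_rotate hrot
  have hdC : DifferentiableAt ℂ (f ∘ (extChartAt 𝓘(ℝ, E) x).symm) (extChartAt 𝓘(ℝ, E) x x) :=
    (differentiableAt_iff_restrictScalars ℝ hdR).2 ⟨g, hg⟩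
  -- back to the manifold
  have hcont : ContinuousAt f x := by
    have h1 : ContinuousAt (f ∘ (extChartAt 𝓘(ℝ, E) x).symm) (extChartAt 𝓘(ℝ, E) x x) :=
      hdC.continuousAt
    have h2 : ContinuousAt (extChartAt 𝓘(ℝ, E) x) x := continuousAt_extChartAt x
    have h3 := h1.comp h2
    refine h3.congr ?_
    filter_upwards [extChartAt_source_mem_nhds (I := 𝓘(ℝ, E)) x] with y hy
    simp only [Function.comp_apply]
    rw [(extChartAt 𝓘(ℝ, E) x).left_inv hy]
  have hmd : MDifferentiableAt 𝓘(ℂ, E) 𝓘(ℂ, ℂ) f x := by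
    rw [mdifferentiableAt_iff (I := 𝓘(ℂ, E)) (I' := 𝓘(ℂ, ℂ)) f x]
    refine ⟨hcont, ?_⟩
    simp only [writtenInExtChartAt, extChartAt_model_space_eq_id, PartialEquiv.refl_coe,
      Function.id_comp, ModelWithCorners.Boundaryless.range_eq_univ, differentiableWithinAt_univ]
    exact hdC
  exact hmd.mdifferentiableWithinAt

variable [IsManifold 𝓘(ℂ, E) ω M]

omit [IsManifold 𝓘(ℂ, E) ω M] in
/-- **Holomorphic functions are `∂̄`-closed**: `∂̄f = 0` at the points of an open set on which `f`
is holomorphic. [cite: VoisinHodgeI2002, §2.3.3 Lemma 2.29] -/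
theorem dolbeaultBar_ofFun_eq_zero_of_mdifferentiableOn {V : Set M} (hV : IsOpen V) {f : M → ℂ}
    (hf : MDifferentiableOn 𝓘(ℂ, E) 𝓘(ℂ, ℂ) f V) {x : M} (hx : x ∈ V) :
    dolbeaultBar (MForm.ofFun 𝓘(ℝ, E) f) x = 0 := by
  rw [dolbeaultBar_zeroForm, typeComponent_zero_one_apply_eq_zero_iff, mextDeriv_ofFun_rotate_iff]
  have hdC : DifferentiableAt ℂ (f ∘ (extChartAt 𝓘(ℝ, E) x).symm) (extChartAt 𝓘(ℝ, E) x x) :=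
    differentiableAt_comp_extChartAt_symm_of_mdifferentiableAt
      ((hf x hx).mdifferentiableAt (hV.mem_nhds hx))
  intro θ w
  rw [hdC.fderiv_restrictScalars ℝ, ContinuousLinearMap.coe_restrictScalars', map_smul, smul_eq_mul]

omit [IsManifold 𝓘(ℂ, E) ω M] in
/-- **`∂f = df` for holomorphic `f`** (pointwise on the open set of holomorphy). [cite: VoisinHodgeI2002, §2.3.3] -/
theorem dolbeault_ofFun_eq_mextDeriv_of_mdifferentiableOn {V : Set M} (hV : IsOpen V) {f : M → ℂ}
    (hf : MDifferentiableOn 𝓘(ℂ, E) 𝓘(ℂ, ℂ) f V) {x : M} (hx : x ∈ V) :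
    dolbeault (MForm.ofFun 𝓘(ℝ, E) f) x = mextDeriv (MForm.ofFun 𝓘(ℝ, E) f) x := by
  rw [mextDeriv_zeroForm_apply, dolbeaultBar_ofFun_eq_zero_of_mdifferentiableOn hV hf hx, add_zero]

omit [IsManifold 𝓘(ℝ, E) ∞ M] [IsManifold 𝓘(ℂ, E) ω M] in
/-- The `0`-form of `conj ∘ K` is the conjugate of the `0`-form of `K`. [folklore] -/
theorem ofFun_conj (K : M → ℂ) :
    (MForm.ofFun 𝓘(ℝ, E) fun y ↦ conj (K y)) = (MForm.ofFun 𝓘(ℝ, E) K).conj := by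
  funext x; ext v; rfl

omit [IsManifold 𝓘(ℝ, E) ∞ M] [IsManifold 𝓘(ℂ, E) ω M] in
/-- Conjugating twice gives the form back. [folklore] -/
theorem conj_conj_form {k : ℕ} (α : MForm 𝓘(ℝ, E) M ℂ k) : α.conj.conj = α := by
  funext x; ext v; simp [MForm.conj]

omit [IsManifold 𝓘(ℂ, E) ω M] in
/-- **`∂f = 0` for antiholomorphic `f`** (`conj ∘ f` holomorphic), pointwise on the open set.
[cite: VoisinHodgeI2002, §2.3.1, proof of Lemma 2.28] -/
theorem dolbeault_ofFun_eq_zero_of_conj_mdifferentiableOn {V : Set M} (hV : IsOpen V) {K : M → ℂ}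
    (hK : MDifferentiableOn 𝓘(ℂ, E) 𝓘(ℂ, ℂ) (fun y ↦ conj (K y)) V) {x : M} (hx : x ∈ V) :
    dolbeault (MForm.ofFun 𝓘(ℝ, E) K) x = 0 := by
  have h : MForm.ofFun 𝓘(ℝ, E) K = (MForm.ofFun 𝓘(ℝ, E) fun y ↦ conj (K y)).conj := by
    rw [ofFun_conj, conj_conj_form]
  rw [h, dolbeault_conj']
  change (Complex.conjCLE : ℂ →L[ℝ] ℂ).compContinuousAlternatingMap
    (dolbeaultBar (MForm.ofFun 𝓘(ℝ, E) fun y ↦ conj (K y)) x) = 0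
  rw [dolbeaultBar_ofFun_eq_zero_of_mdifferentiableOn hV hK hx]
  ext v; simp

/-- Antiholomorphic functions are real-`C^∞` (as `0`-forms) on their open set. [folklore] -/
theorem smoothAt_ofFun_of_conj_mdifferentiableOn [FiniteDimensional ℂ E] {V : Set M}
    (hV : IsOpen V) {K : M → ℂ} (hK : MDifferentiableOn 𝓘(ℂ, E) 𝓘(ℂ, ℂ) (fun y ↦ conj (K y)) V)
    {x : M} (hx : x ∈ V) : (MForm.ofFun 𝓘(ℝ, E) K).SmoothAt x := by
  have h1 : ContMDiffAt 𝓘(ℝ, E) 𝓘(ℝ, ℂ) ∞ (fun y ↦ conj (K y)) x :=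
    contMDiffAt_real_of_mdifferentiableOn_complex hK hV hx
  have h2 : ContMDiffAt 𝓘(ℝ, E) 𝓘(ℝ, ℂ) ∞ (fun y ↦ conj (conj (K y))) x :=
    (Complex.conjCLE.contDiff.contDiffAt).comp_contMDiffAt h1
  simp only [Complex.conj_conj] at h2
  exact MForm.smoothAt_ofFun_of_contMDiffAt h2

end Holomorphy

end Summit.HodgeConjecture.HodgeConjecture.Theorems

end
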